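import Summits.ValiantsHypothesis.ValiantsHypothesis.Theorems.TameSensitivityQuantHrubesRep
import Summits.ValiantsHypothesis.ValiantsHypothesis.Theorems.CirculantFourierHrubesBridge
import Literature.Computability.AlgebraicComplexity.StandardFamiliesProofs
import Literature.Computability.AlgebraicComplexity.ValiantClasses
import HarnessLib


/-!
# Route TameSensitivity — the quantitative Hrubeš simulation `QuantHrubesPer`
(items stmt-ValiantsHypothesis-23473 and stmt-ValiantsHypothesis-23515)

`QuantHrubesPer` is the support item B2 of route `TameSensitivity` (and, verbatim, a support item
of route `DecompCycle1`): Hrubeš's ε-sensitive monotone simulation (P. Hrubeš, *On ε-sensitive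
monotone computations*, Comput. Complexity 29 (2020) Art. 6, §4 Theorem 1) for the permanent
with an EXPLICIT threshold — for every fan-in-two real circuit `P` of size `≤ m` computing
`per_n` and every `0 < ε ≤ 1` with `ε · |P|(1,…,1) ≤ 1`, where `|P|` is the abs-value twin
`P.mapConsts (fun c => |c|)`, the polynomial `(1 + Σ x_ij)^n + ε per_n` is (the image of) a
polynomial over `ℝ≥0` with a Jerrum–Snir monotone computation of size `≤ t n m`, `t` preserving
p-boundedness (`t n m = 32 (m + n² + n + 1)³`).

Proof (parts A/B = `TameSensitivityQuantHrubesBase` / `TameSensitivityQuantHrubesRep`, this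
file = part C). We re-run the one-pass simulation of
`Theorems/CirculantFourierHrubesBridgeRep.lean` (route `CirculantFourier`, item `HrubesBridge`;
its part A `CirculantFourierHrubesBridgeGates` is imported and used as is) with ONE extra
conjunct in the invariant: the constants `c_k` of the representation
`P_k - Q_k = w^{(k)}`, `P_k + Q_k = c_k L^k` of a gate value `w` are bounded by the all-ones
evaluation of the degree-`k` part of the corresponding gate value of the abs-value twin circuit
over `ℝ≥0` (`gates.map (Gate.map Real.nnabs)`): `c_k ≤ ŵ^{(k)}(1,…,1)`. The bound is compatible
with every step (constants: `|γ|`; variables: `1`; sums add; scalars multiply by `|γ|`; products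
convolve, `homogeneousComponent_mul_eq_sum`). At the output, `c_k ≤ f̂^{(k)}(1) ≤ f̂(1) = |P|(1)`,
so `ε c_k ≤ ε |P|(1) ≤ 1 ≤ C(d,k)` and the monotone normal form
`(1 + L)^d + ε f = Σ_k (C(d,k) - ε c_k) L^k + 2ε Σ_k P_k` (`CirculantFourierHrubes.final_poly`
and the size arithmetic `CirculantFourierHrubes.size_arith`, imported from
`Theorems/CirculantFourierHrubesBridge.lean`) applies. The item is stated verbatim (the gate
matches it against the route decls `Theses.TameSensitivity.QuantHrubesPer` /
`Theses.DecompCycle1.QuantHrubesPer`; importing those route files here would create an import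
cycle with the `_holds` link).

Honest framing: an explicit-constant version of a published simulation theorem, closing a
provable-now SUPPORT item of two open routes; nothing here bears on VP ≠ VNP itself.

## References

* [Hrubes2020] P. Hrubeš, *On ε-sensitive monotone computations*, Comput. Complexity 29 (2020)
  Art. 6 (ECCC TR19-034), §4: Lemma 22, Lemma 23, Theorem 1 (restated) and its proof.
* [JerrumSnir1982] M. Jerrum, M. Snir, J. ACM 29 (1982), §2.2 (the monotone model).
* [Burgisser2000] P. Bürgisser, *Completeness and Reduction in Algebraic Complexity Theory*,
  Def. 2.1, §4.1 (circuits, change of constants).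
-/

noncomputable section

-- `Summit.ValiantsHypothesis.ValiantsHypothesis.…` is the tree's mandated layout (Sub = Summit).
set_option linter.dupNamespace false

namespace Summit.ValiantsHypothesis.ValiantsHypothesis.Theorems.TameSensitivityQuantHrubes

open MvPolynomial Literature.Computability.AlgebraicComplexity ArithCircuit
  Literature.Barriers.ValiantsHypothesis
open Summit.ValiantsHypothesis.ValiantsHypothesis.Theorems.CirculantFourierHrubes
open scoped NNReal

variable {σ : Type*}

/-! ### The quantitative simulation theorem -/

section Final

variable [Fintype σ] [DecidableEq σ]

/-- **Hrubeš 2020, Theorem 1, with an explicit threshold.** If a fan-in-two real circuit `P₀`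
computes `f` of degree `≤ d` and `ε > 0` satisfies `ε · |P₀|(1,…,1) ≤ 1` (`|P₀|` the abs-value
twin `P₀.mapConsts (fun c => |c|)`), then `(1 + Σ x_i)^d + ε f` is the image of a polynomial over
`ℝ≥0` with a plain fan-in-two monotone computation of size
`≤ |P₀| · 2(#σ + 2 + 8(d+1)²) + (#σ + 2) + (#σ + 3(d+1) + d + 2)`. The printed `ε₀ = 1/R`,
`R = Σ_k R_k`, is made explicit through `R_k ≤ |P₀|^{(k)}(1) ≤ |P₀|(1)`. -/
theorem quantHrubes {d : ℕ} (P₀ : ArithCircuit ℝ σ) (hfan : P₀.IsFanInTwo)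
    {f : MvPolynomial σ ℝ} (hcomp : P₀.Computes f) (hf : f.totalDegree ≤ d) {ε : ℝ} (hε : 0 < ε)
    (hεR : ε * MvPolynomial.eval (fun _ => (1 : ℝ)) (P₀.mapConsts (fun c : ℝ => |c|)).eval ≤ 1) :
    ∃ (g : MvPolynomial σ ℝ≥0) (R : ArithCircuit ℝ≥0 σ),
      MvPolynomial.map NNReal.toRealHom g = (1 + ∑ i, X i) ^ d + C ε * f ∧
      IsMonotoneComputation R g ∧
      R.size ≤ P₀.size * (2 * (Fintype.card σ + 2 + 8 * (d + 1) ^ 2)) + (Fintype.card σ + 2) +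
        (Fintype.card σ + 3 * (d + 1) + d + 2) := by
  obtain ⟨gs, hgs, hlen, hrep⟩ := repB_gates (σ := σ) d P₀.gates hfan
  obtain ⟨gs₁, hg₁, hl₁, hrf⟩ := repB_operand hgs d _ _ hrep P₀.output
  have hcomp' : P₀.output.eval (gateValues P₀.gates) = f := hcomp
  have htwin : (P₀.output.map Real.nnabs).eval (gateValues (P₀.gates.map (Gate.map Real.nnabs))) =
      (P₀.mapConsts Real.nnabs).eval := rfl
  rw [hcomp', htwin] at hrf
  obtain ⟨P, Q, c, hPQ⟩ := hrf
  have hεc : ∀ k ≤ d, ε * (c k : ℝ) ≤ 1 := by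
    intro k hk
    obtain ⟨-, -, -, -, hb⟩ := hPQ k hk
    have h1 : (c k : ℝ) ≤
        MvPolynomial.eval (fun _ => (1 : ℝ)) (P₀.mapConsts (fun c : ℝ => |c|)).eval := by
      rw [← coe_eval_one_twin, NNReal.coe_le_coe]
      exact hb.trans (ev_hc_le _ _)
    calc ε * (c k : ℝ)
        ≤ ε * MvPolynomial.eval (fun _ => (1 : ℝ)) (P₀.mapConsts (fun c : ℝ => |c|)).eval :=
          mul_le_mul_of_nonneg_left h1 hε.le
      _ ≤ 1 := hεR
  obtain ⟨g, R, hg, hR, hRsize⟩ := final_poly hg₁ hf P Q c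
    (fun k hk => ⟨(hPQ k hk).1, (hPQ k hk).2.1, (hPQ k hk).2.2.1, (hPQ k hk).2.2.2.1⟩) hε hεc
  refine ⟨g, R, hg, hR, ?_⟩
  rw [List.length_append] at hRsize
  have hsz : P₀.gates.length = P₀.size := rfl
  rw [hsz] at hlen
  calc R.size ≤ gs.length + gs₁.length + (Fintype.card σ + 3 * (d + 1) + d + 2) := hRsize
    _ ≤ _ := Nat.add_le_add_right (Nat.add_le_add hlen hl₁) _

end Final

/-! ### The item -/

/-- **`QuantHrubesPer`** (items stmt-ValiantsHypothesis-23473 of route `TameSensitivity` and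
stmt-ValiantsHypothesis-23515 of route `DecompCycle1`, stated verbatim): the quantitative Hrubeš
simulation for the permanent, with size overhead `t n m = 32 (m + n² + n + 1)³` (p-bounded in
`n` along any p-bounded `m = s(n)`) and threshold "`ε · |P|(1,…,1) ≤ 1`". Proof: `quantHrubes`
with `σ = Fin n × Fin n`, `d = n = deg per_n` (`totalDegree_perPoly_holds`), and
`CirculantFourierHrubes.size_arith`.
[cite: Hrubes2020, §4 Theorem 1 (restated) and its proof] -/
theorem quantHrubesPer : ∃ t : ℕ → ℕ → ℕ, (∀ s : ℕ → ℕ, Literature.Computability.AlgebraicComplexity.IsPBounded s → Literature.Computability.AlgebraicComplexity.IsPBounded fun n => t n (s n)) ∧ ∀ (n : ℕ) (P : Literature.Computability.AlgebraicComplexity.ArithCircuit ℝ (Fin n × Fin n)) (m : ℕ), P.IsFanInTwo → P.Computes (Literature.Computability.AlgebraicComplexity.perPoly (Fin n) ℝ) → P.size ≤ m → ∀ ε : ℝ, 0 < ε → ε ≤ 1 → ε * MvPolynomial.eval (fun _ => (1 : ℝ)) (Literature.Computability.AlgebraicComplexity.ArithCircuit.mapConsts (fun c : ℝ => |c|) P).eval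 ≤ 1 → ∃ (g : MvPolynomial (Fin n × Fin n) NNReal) (Q : Literature.Computability.AlgebraicComplexity.ArithCircuit NNReal (Fin n × Fin n)), MvPolynomial.map NNReal.toRealHom g = (1 + ∑ ij : Fin n × Fin n, MvPolynomial.X ij) ^ n + MvPolynomial.C ε * Literature.Computability.AlgebraicComplexity.perPoly (Fin n) ℝ ∧ Literature.Barriers.ValiantsHypothesis.IsMonotoneComputation Q g ∧ Q.size ≤ t n m := by
  refine ⟨fun n m => 32 * (m + n * n + n + 1) ^ 3, ?_, ?_⟩
  · intro s hs
    exact IsPBounded.mul_holds (IsPBounded.const 32)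
      (IsPBounded.pow_holds
        (IsPBounded.add_holds
          (IsPBounded.add_holds
            (IsPBounded.add_holds hs (IsPBounded.mul_holds IsPBounded.id IsPBounded.id))
            IsPBounded.id)
          (IsPBounded.const 1)) 3)
  · intro n P m hfan hcomp hsize ε hε _hε1 hεR
    have hdeg : (perPoly (Fin n) ℝ).totalDegree ≤ n := by
      rw [totalDegree_perPoly_holds (n := Fin n) (k := ℝ), Fintype.card_fin]
    obtain ⟨g, R, hg, hR, hRsize⟩ := quantHrubes P hfan hcomp hdeg hε hεR
    refine ⟨g, R, hg, hR, hRsize.trans ?_⟩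
    have hcard : Fintype.card (Fin n × Fin n) = n * n := by simp
    rw [hcard]
    calc P.size * (2 * (n * n + 2 + 8 * (n + 1) ^ 2)) + (n * n + 2) +
          (n * n + 3 * (n + 1) + n + 2)
        ≤ m * (2 * (n * n + 2 + 8 * (n + 1) ^ 2)) + (n * n + 2) +
          (n * n + 3 * (n + 1) + n + 2) :=
          Nat.add_le_add_right (Nat.add_le_add_right (Nat.mul_le_mul_right _ hsize) _) _
      _ ≤ 32 * (m + n * n + n + 1) ^ 3 := size_arith m (n * n) n

end Summit.ValiantsHypothesis.ValiantsHypothesis.Theorems.TameSensitivityQuantHrubes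

end
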